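/-
Copyright: the b2b-balaban T⁴-continuum CRUX team, row NE7b OWNER lineage `t4-ne7b-p1` (gen 123). Project licence.
-/
import Summits.QuantumFields.BalabanUV.T4Continuum.Spine.NE7b.SupZdPropagatorUniqueness

/-!
# THE TORUS PROPAGATORS ARE THE INFINITE-VOLUME PROPAGATOR WITH PERIODIC DATA: for every fine torus `T = Site d ((n+1)s)`, every torus
# datum `V_t : T → [−λ, Λ]`, `f_t`, the lift `u_t∘σ` of the torus solution of `H[V_t]u_t = f_t` solves the `ℤ^d` equation with the
# periodic data `V_t∘σ`, `f_t∘σ` and IS the unique bounded `ℤ^d` solution ((181)); hence for `(n+1)s`-PERIODIC data `V, f` on `ℤ^d` every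
# bounded `ℤ^d` solution is `(n+1)s`-periodic and equals the lifted torus solution with the window data `V∘wm`, `f∘wm` — the `ℤ^d` object
# of (180)–(184) and the torus road of (89)–(179) are ONE column, `d ≥ 3`, every mesh, every volume (row NE7b, node U5c; (148)∕(158)∕(181) +
# PTC BY NAME; [folklore])

Cell `pub-balaban`, sub-cell `t4`, spine estimate NE7b (`T4WeightBudget.RelWeightBound`; the cell's OWN estimate — NOT PRINTED in
[Bałaban 1983–89], NOT PROVED).  Crux-route work under `Spine/NE7b/` by the row OWNER (`t4-ne7b-p1` gen 123, file (185)) under FREEZE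
(0)'s crux-prover clause; NOTHING of Bałaban's is named as a Lean object, valued or asserted; no `T4Continuum/Support` leaf typed; no `def`,
no notation (the `ℤ^d` operator and the torus action DISPLAYED); zero `sorry`.  Imports (BY NAME): the OWNER's (181)
`…SupZdPropagatorUniqueness` (`zd_bounded_solution_unique`; through it (148) `action_surjective`, PTC `exists_windowMap_siteOf`,
`apply_windowMap_siteOf`, `siteOf_add_smul`, `natCast_mul_smul_eq`, (55) `blk_translate`, `sum_B_translate`, TDFC `comp_siteOf_periodic`,
`Beta.siteOf_add` ∕ `siteOf_sub`).

WHY (located).  (180)–(184) built the linear column on `ℤ^d` as a LIMIT of torus solutions with window data; conversely every torus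
solution is an infinite-volume solution with periodic data: the lift `u_t∘σ` satisfies the `ℤ^d` equation at `p` because `σ(p ± ê) = σ p ±
σ ê` and the block of the window representative of `σ p` is a period translate of the block of `p` (the block sum of a periodic lift is
translation invariant — (158) `action_lift`'s computation for the identity covering), it is bounded (finite torus), and (181) makes it
THE bounded solution.  For periodic `ℤ^d` data `V = (V∘wm)∘σ` ((PTC) `apply_windowMap_siteOf`), so every bounded solution is the lift of
the torus solution with window data ((148)), in particular periodic.

WHAT IS PROVED ([folklore]; `X d = ℤ^d`, `T = Site d ((n+1)s)`, `σ = siteOf`, `wm = windowMap`; the `ℤ^d` operator `(H_V u)(p) =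
(n+1)²Σ_μ(2u p − u(p + ê_μ) − u(p − ê_μ)) + a(n+1)^{−d}Σ_{q ∈ B n (blk n p)}u q + V p·u p` and the torus action DISPLAYED):
* §1 **`torus_solution_lifts`** (`H[V_t]u_t = f_t` on `T` ⟹ `H_{V_t∘σ}(u_t∘σ) = f_t∘σ` on `ℤ^d`), `torus_lift_bounded` (`|u_t∘σ| ≤ max|u_t|`).
* §2 **`zd_solution_eq_torus_lift`** (`d ≥ 3`, `a > 0`, `λ < min(2,a)`, `Λ ≥ 0`, `V_t : T → [−λ, Λ]`: a BOUNDED `ℤ^d` solution with data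
  `V_t∘σ`, `f_t∘σ` equals `u_t∘σ`); **`zd_solution_periodic`** (`(n+1)s`-periodic `V : ℤ^d → [−λ, Λ]` and `f`: every bounded `ℤ^d` solution of
  `H_V u = f` is `(n+1)s`-periodic).
* §3 toy (`d = 3`).

HONEST (what this is NOT).  The LINEAR column only; `d ≥ 3` only (through (181)); scalar skeleton ((A3), NC-NE7b-α UNRULED); nothing of the
covariant propagators of [B4]–[B6]; nothing of Bałaban's.  BY-NAME EFFECT ON THE WALL: NONE.  NE7b NOT PRINTED ∕ NOT PROVED; spine PROVED
0∕9; rung (B)+1 — the programme's measures remain FINITE-torus statements; NOT the mass gap, NOT Clay.  HONEST DEPENDENCY: continuum YM on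
T⁴ ⇐ BetaPertH ∧ nine spine estimates (0∕9 proved); BetaPertH ⇐ (D1) ∧ (D4) ∧ CAP+tail; G-an2-4 gates asym, D1 and NE2∕3∕4.
-/

set_option autoImplicit false

noncomputable section

namespace Summit.QuantumFields.BalabanUV.T4Continuum.NE7b.SupZdPropagatorPeriodic

open Real Filter Topology
open Literature.MathematicalPhysics.QuantumFieldTheory.Balaban1983to89
open B6QGQLower276 (X e blk B side side_facts chart mem_B sum_B sum_B_const card_cube blk_chart)
open Beta (Site siteOf windowMap siteOf_windowMap siteOf_add siteOf_sub)
open PeriodicSupTorusCarrier (exists_windowMap_siteOf apply_windowMap_siteOf siteOf_add_smul natCast_mul_smul_eq)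
open OneShotChartTorusRowsZd (blk_translate sum_B_translate)
open SupTorusDirichletFormCoercive (comp_siteOf_periodic)
open SupTorusSupNormBound (action_surjective)
open SupZdPropagatorUniqueness (zd_bounded_solution_unique)

variable {d : ℕ}

/-! ## §1. The lift of a torus solution solves the `ℤ^d` equation with the lifted (periodic) data -/

/-- **THE LIFT OF A TORUS SOLUTION IS A `ℤ^d` SOLUTION WITH PERIODIC DATA**: `H[V_t]u_t = f_t` on `T = Site d ((n+1)s)` ⟹ the lift `u_t∘σ`
solves the displayed `ℤ^d` equation with data `V_t∘σ`, `f_t∘σ` at every `p ∈ ℤ^d` — the torus equation at `σ p`, `σ(p ± ê) = σ p ± σ ê`,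
and the block of `wm(σ p)` is a period translate of the block of `p`, along which the periodic lift has the same block sum. [folklore] -/
theorem torus_solution_lifts (n : ℕ) (a : ℝ) (s : ℕ) [NeZero s] (V u f : Site d ((n + 1) * s) → ℝ)
    (hu : ∀ x, ((n : ℝ) + 1) ^ 2 * ∑ μ, (2 * u x - u (x + siteOf d ((n + 1) * s) (e μ)) - u (x - siteOf d ((n + 1) * s) (e μ)))
      + a / ((n : ℝ) + 1) ^ d * ∑ q ∈ B n (blk n (windowMap d ((n + 1) * s) x)), u (siteOf d ((n + 1) * s) q) + V x * u x = f x)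
    (p : X d) :
    ((n : ℝ) + 1) ^ 2 * ∑ μ, (2 * u (siteOf d ((n + 1) * s) p) - u (siteOf d ((n + 1) * s) (p + e μ)) - u (siteOf d ((n + 1) * s) (p - e μ)))
      + a / ((n : ℝ) + 1) ^ d * ∑ q ∈ B n (blk n p), u (siteOf d ((n + 1) * s) q)
      + V (siteOf d ((n + 1) * s) p) * u (siteOf d ((n + 1) * s) p) = f (siteOf d ((n + 1) * s) p) := by
  have h := hu (siteOf d ((n + 1) * s) p)
  simp only [← siteOf_add, ← siteOf_sub] at h
  obtain ⟨m, hm⟩ := exists_windowMap_siteOf ((n + 1) * s) p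
  have hblk : blk n (windowMap d ((n + 1) * s) (siteOf d ((n + 1) * s) p)) = blk n p + (s : ℤ) • m := by
    rw [hm, natCast_mul_smul_eq, blk_translate]
  have hsum : ∑ q ∈ B n (blk n (windowMap d ((n + 1) * s) (siteOf d ((n + 1) * s) p))), u (siteOf d ((n + 1) * s) q)
      = ∑ q ∈ B n (blk n p), u (siteOf d ((n + 1) * s) q) := by
    rw [hblk, sum_B_translate]
    exact Finset.sum_congr rfl fun q _ => comp_siteOf_periodic n s u q m
  rw [hsum] at h
  exact h

/-- The lift of a torus function is bounded by its maximum modulus. [folklore] -/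
theorem torus_lift_bounded (N : ℕ) [NeZero N] (u : Site d N → ℝ) : ∃ Bu : ℝ, ∀ p : X d, |u (siteOf d N p)| ≤ Bu := by
  classical
  obtain ⟨x₀, hx₀⟩ := Finite.exists_max fun x : Site d N => |u x|
  exact ⟨|u x₀|, fun p => hx₀ _⟩

/-! ## §2. THE END: the torus propagator is the infinite-volume propagator with periodic data -/

/-- **A BOUNDED `ℤ^d` SOLUTION WITH LIFTED TORUS DATA IS THE LIFTED TORUS SOLUTION**: `V_t : T → [−λ, Λ]`, `H[V_t]u_t = f_t` on `T`, and `u`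
bounded with `H_{V_t∘σ}u = f_t∘σ` on `ℤ^d` ⟹ `u = u_t∘σ` (§1 and (181) uniqueness), `d ≥ 3`, every mesh, every volume. [folklore] -/
theorem zd_solution_eq_torus_lift (hd : 3 ≤ d) (a : ℝ) (ha : 0 < a) {lam Lam : ℝ} (hlam : lam < min 2 a) (hLam : 0 ≤ Lam)
    (n s : ℕ) [NeZero s] (Vt ut ft : Site d ((n + 1) * s) → ℝ) (hV : ∀ x, -lam ≤ Vt x) (hV' : ∀ x, Vt x ≤ Lam)
    (hut : ∀ x, ((n : ℝ) + 1) ^ 2 * ∑ μ, (2 * ut x - ut (x + siteOf d ((n + 1) * s) (e μ)) - ut (x - siteOf d ((n + 1) * s) (e μ)))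
      + a / ((n : ℝ) + 1) ^ d * ∑ q ∈ B n (blk n (windowMap d ((n + 1) * s) x)), ut (siteOf d ((n + 1) * s) q) + Vt x * ut x = ft x)
    (u : X d → ℝ) {Bu : ℝ} (huB : ∀ p, |u p| ≤ Bu)
    (hu : ∀ p, ((n : ℝ) + 1) ^ 2 * ∑ μ, (2 * u p - u (p + e μ) - u (p - e μ))
      + a / ((n : ℝ) + 1) ^ d * ∑ q ∈ B n (blk n p), u q + Vt (siteOf d ((n + 1) * s) p) * u p = ft (siteOf d ((n + 1) * s) p)) :
    u = fun p => ut (siteOf d ((n + 1) * s) p) := by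
  obtain ⟨B', hB'⟩ := torus_lift_bounded (d := d) ((n + 1) * s) ut
  exact zd_bounded_solution_unique hd a ha hlam hLam n (fun p => Vt (siteOf d ((n + 1) * s) p)) (fun p => hV _) (fun p => hV' _)
    (fun p => ft (siteOf d ((n + 1) * s) p)) u (fun p => ut (siteOf d ((n + 1) * s) p)) huB hB' hu
    (fun p => torus_solution_lifts n a s Vt ut ft hut p)

/-- **HEADLINE — PERIODIC DATA GIVE PERIODIC SOLUTIONS, WHICH ARE THE TORUS SOLUTIONS**: `V : ℤ^d → [−λ, Λ]` and `f` both `(n+1)s`-periodic,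
`u` a BOUNDED solution of `H_V u = f` on `ℤ^d` ⟹ `u` is `(n+1)s`-periodic, `d ≥ 3`, every mesh, every volume — `V = (V∘wm)∘σ`, `f = (f∘wm)∘σ`
(PTC `apply_windowMap_siteOf`), the torus solution with window data exists ((148)), and `u` is its lift (`zd_solution_eq_torus_lift`),
which is periodic (`σ(p + ((n+1)s)•t) = σ p`). [folklore] -/
theorem zd_solution_periodic (hd : 3 ≤ d) (a : ℝ) (ha : 0 < a) {lam Lam : ℝ} (hlam : lam < min 2 a) (hLam : 0 ≤ Lam)
    (n s : ℕ) [NeZero s] (V f : X d → ℝ) (hV : ∀ p, -lam ≤ V p) (hV' : ∀ p, V p ≤ Lam)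
    (hVper : ∀ q t : X d, V (q + (((n + 1) * s : ℕ) : ℤ) • t) = V q) (hfper : ∀ q t : X d, f (q + (((n + 1) * s : ℕ) : ℤ) • t) = f q)
    (u : X d → ℝ) {Bu : ℝ} (huB : ∀ p, |u p| ≤ Bu)
    (hu : ∀ p, ((n : ℝ) + 1) ^ 2 * ∑ μ, (2 * u p - u (p + e μ) - u (p - e μ))
      + a / ((n : ℝ) + 1) ^ d * ∑ q ∈ B n (blk n p), u q + V p * u p = f p) :
    ∀ q t : X d, u (q + (((n + 1) * s : ℕ) : ℤ) • t) = u q := by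
  have hm0 : 0 < min 2 a - lam := by linarith
  -- the torus solution with window data
  obtain ⟨ut, hut⟩ := action_surjective n a s ha.le hm0 (fun x => V (windowMap d ((n + 1) * s) x)) (fun x => hV _)
    (fun x => f (windowMap d ((n + 1) * s) x))
  -- the `ℤ^d` equation of `u` reads with the lifted window data (periodicity)
  have hu' : ∀ p, ((n : ℝ) + 1) ^ 2 * ∑ μ, (2 * u p - u (p + e μ) - u (p - e μ))
      + a / ((n : ℝ) + 1) ^ d * ∑ q ∈ B n (blk n p), u q
      + V (windowMap d ((n + 1) * s) (siteOf d ((n + 1) * s) p)) * u p = f (windowMap d ((n + 1) * s) (siteOf d ((n + 1) * s) p)) := by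
    intro p
    rw [apply_windowMap_siteOf hVper, apply_windowMap_siteOf hfper]
    exact hu p
  have hueq := zd_solution_eq_torus_lift hd a ha hlam hLam n s (fun x => V (windowMap d ((n + 1) * s) x)) ut
    (fun x => f (windowMap d ((n + 1) * s) x)) (fun x => hV _) (fun x => hV' _) hut u huB hu'
  intro q t
  rw [hueq]
  simp only [siteOf_add_smul]

/-! ## §3. Toy -/

/-- Toy (`d = 3`, `N = 1`): the lift of a torus function is bounded. -/
example (u : Site 3 1 → ℝ) : ∃ Bu : ℝ, ∀ p : X 3, |u (siteOf 3 1 p)| ≤ Bu := torus_lift_bounded (d := 3) 1 u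

end Summit.QuantumFields.BalabanUV.T4Continuum.NE7b.SupZdPropagatorPeriodic
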